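/-
Copyright (c) 2026 the pub-hodgecm-mathlib formalisation cell (harness21).  Prover seat hodgecm-mathlib-LH4-p04 (g8), req620 Track A «(D-RAM) FOUR-FRAME» squad
(STAGE-1b, row (2) of the piece `f_{T₊}`, the (β₂) road; dealer∕pen LH4-plan (g13) WORD #108 (4) ∕ WORD #112 (1): «(S4) β₂ ASSEMBLY», LH4-p04 lineage; brick (S4-OF-axis)), 2026-09-04.
-/
import Summits.HodgeConjecture.HodgeConjecture.Theorems.F0P3cDyRamBlockCensusOrderForm   -- ★ (C1) (LH4-p12 (g4)): brings ★ W4 `…WSideOrderCensus` (`setOf_orderLatt_selfDual_eq_iUnion`, `eq_of_mem_levelSet_of_mem_levelSet`, `not_isOrd_pow_of_lt`), ★ (C) `EllipticPlaneAsFieldLine` legs, ★ DEFS `levelSet`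
import HarnessLib

/-!
# Crux `H413`, line LH4 «(D-RAM) FOUR-FRAME» — STAGE-1b, row (2), the (β₂) road, brick (S4-OF-axis): «THE LABELLED AXIS TERM IN M-LETTERS»
# `#{B₂ ∣ B₂ self-dual for H₂, γ₂B₂ = B₂, P₂ B₂} = Σ_{j < J+1} [IsOrd (jE ϖ^j) lam]·#(levelSet(j, 0) ∩ {Λ ∣ q Λ})`

Cell `hodgecm-mathlib` (D-0151), FLOOR 0, crux item H413 = `stmt-HodgeConjecture-24833`, route of record `HCCMUnconditional`; squad F0∕P3c∕LH4; lane
`--supports stmt-HodgeConjecture-24833 --as helper` (count-neutral; pays NO tier-0 row).  THEOREMS ONLY (no `def`, no instance, no notation, no `sorry`, default heartbeats).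
DATUM-FREE: abstract valued fields `E` (the plane) and `M` (the line model); no residue field, no `|2|`, no PID.

WHY.  ★-cand `…BlockCensusOrderFormLabelled.ncard_fixed_selfDual_endoGL_sep_eq_orderForm` (this seat, (S4-OF)) reads the LABELLED fixed-vertex count of a unitary block element in
M-letters on the cone layers `b ≥ 1` and leaves the AXIS term `#{B₂ ∣ SD for H₂, γ₂B₂ = B₂, Q₂ B₂}` on the plane (as ★ p860968 §3 does).  The (β₂-H) balance on AXIS cells (★ p860765
§2 `ncard_levelSet_sep_eq_of_smul_labelReversing`, ★ p860839 §1; F0P3-p01 (g36) TORUS-FLIP PROBE: the `b = 0` cells `(7,0)`, `(8,0)` flip `16+16`) speaks `levelSet(j, 0)` letters — so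
the axis term must be read on the line model too, WITH its label.  The unlabelled reading is ★ (C1) §1 `ncard_selfDual_fixed_plane_eq_sum_levelSet_zero` = ★ (C)
`ncard_selfDual_fixed_eq_ncard_orderLatt` (bijection `B ↦ φ(B)` onto the `lam`-stable hermitian-self-dual ORDER LATTICES) ∘ ★ W4 `ncard_orderLatt_selfDual_eq_sum` (census by
conductor).  THIS FILE carries a plane label `P₂` ∕ M-label `q` (dictionary `hq : SD B → γ₂B = B → (P₂ B ↔ q φ(B))`) through both:
* §1 `ncard_selfDual_fixed_sep_eq_ncard_orderLatt_sep` — ★ (C)'s bijection with the label conjunct (the same three legs: ★ (D1) `exists_eq_mul_order_map_latt`, ★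
  `mapGL_eq_iff_forall_mul_mem`, ★ `forall_herm_iff_mem_of_dualLatt_eq` ∕ `dualLatt_eq_of_forall_herm_iff_mem`, ★ `exists_latt_map_eq_of_order`).
* §2 `ncard_orderLatt_selfDual_sep_eq_sum` — ★ W4 with the label conjunct: `#{Λ ∣ order ∧ lam-stable ∧ self-dual ∧ q Λ} = Σ_{j < J+1} [IsOrd (ϖE^j) lam]·#(levelSet(j, 0) ∩ {q})`
  (★ (W4a) `setOf_orderLatt_selfDual_eq_iUnion` intersected with `{q}`, disjointness ★ `eq_of_mem_levelSet_of_mem_levelSet`, truncation ★ `not_isOrd_pow_of_lt`).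
* §3 HEAD `ncard_selfDual_fixed_plane_sep_eq_sum_levelSet_zero` — §1 ∘ §2: the LABELLED AXIS TERM IN M-LETTERS, in ★ (C1) §1's binder shape plus `(P₂) (q) (hq)`.
At `P₂, q := ⊤` each statement is its ★ unlabelled twin.
HONEST LABEL.  Count-neutral lattice bookkeeping; nothing printed is asserted; no census law is stated; (β₂) ∕ `betaT2lit` stay HYPOTHESES; `HC_CM` is proved only modulo the
7 printed citations (2 remaining named inputs: hLiu418 = `stmt-HodgeConjecture-24832`, h413 = `stmt-HodgeConjecture-24833`) until rung 0 closes.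
## References
* [Kottwitz1986BaseChangeUnits] R. E. Kottwitz, *Base change for unit elements of Hecke algebras*, Compositio Math. 60 (1986), §1 pp. 240–241.
* [Flicker1998UnitaryFL] Y. Z. Flicker, *Elementary proof of the fundamental lemma for a unitary group*, Canad. J. Math. 50 (1998), p. 84 REMARK (Mars: lattices `z·R_E(j)`).
* [Jacobowitz1962] R. Jacobowitz, *Hermitian forms over local fields*, Amer. J. Math. 84 (1962), §4, §7.
* [BruhatTits1972] F. Bruhat, J. Tits, *Groupes réductifs sur un corps local I*, Publ. Math. IHÉS 41 (1972), §10.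
-/

set_option autoImplicit false

noncomputable section

open scoped Valued WithZero Matrix MatrixGroups
open WithZero
open scoped Classical
open Literature.NumberTheory.Automorphic Literature.NumberTheory.Automorphic.HermitianLattice Literature.NumberTheory.Automorphic.UnitaryLatticeTree
open Literature.NumberTheory.Rogawski1990
open Literature.NumberTheory.Automorphic.EllipticPlaneAsFieldLine
open Literature.NumberTheory.LocalFields.QuadraticOrder
open Summit.HodgeConjecture.HodgeConjecture.Cruxes.H413.F0P3cDyRamToricCensusDefs
open Summit.HodgeConjecture.HodgeConjecture.Cruxes.H413.F0P3cDyRamWSideOrderCensus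

namespace Summit.HodgeConjecture.HodgeConjecture.Cruxes.H413.F0P3cDyRamWSideOrderCensusLabelled

variable {E M : Type*} [Field E] [Valued E ℤᵐ⁰] [Field M] [Valued M ℤᵐ⁰] {ρ Θ : M →+* M} {α : M}

/-! ## §1 ★ (C) with a label: the labelled count transport `B ↦ φ(B)` -/

/-- **(C) WITH A LABEL.**  The `γ₂`-fixed self-dual plane lattices CARRYING `P₂` are equinumerous with the `lam`-stable hermitian-self-dual order lattices of the line model CARRYING
`q`, for any plane label `P₂` and M-label `q` that agree along `B ↦ φ(B)` on the fixed self-dual lattices (`hq`).  ★ (C) `ncard_selfDual_fixed_eq_ncard_orderLatt`'s bijection with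
one more conjunct. [cite: Kottwitz1986BaseChangeUnits, §1 pp. 240–241] [cite: Flicker1998UnitaryFL, p. 84 REMARK] [cite: Jacobowitz1962, §4] -/
theorem ncard_selfDual_fixed_sep_eq_ncard_orderLatt_sep (σ : E →+* E) (hvσ : ∀ a, Valued.v (σ a) = Valued.v a) {ϖ : E} (hϖ0 : ϖ ≠ 0) (hϖ1 : Valued.v ϖ ≤ 1)
    {H₂ : Matrix (Fin 2) (Fin 2) E} (hH₂ : IsUnit H₂.det) (jE : E →+* M)
    (hρρ : ∀ x, ρ (ρ x) = x) (hvρ : ∀ x, Valued.v (ρ x) = Valued.v x) (hα : ρ α ≠ α) (hα1 : Valued.v α ≤ 1)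
    (hint : ∀ z : M, Valued.v z ≤ 1 → Valued.v ((z - ρ z) / (α - ρ α)) ≤ 1)
    (hjv : ∀ c, Valued.v (jE c) ≤ 1 ↔ Valued.v c ≤ 1) (hjfix : ∀ z, ρ z = z ↔ ∃ c, jE c = z)
    (φ : (Fin 2 → E) →+ M) (hφs : ∀ (c : E) (x : Fin 2 → E), φ (c • x) = jE c * φ x) (hφi : Function.Injective φ) (hφo : Function.Surjective φ)
    {γ₂ : GL (Fin 2) E} {lam h : M} (hφγ : ∀ x, φ ((γ₂ : Matrix (Fin 2) (Fin 2) E).mulVec x) = lam * φ x) (hlam : Valued.v lam = 1)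
    (hform : ∀ x y, jE (pairing σ H₂ x y) = h * Θ (φ x) * φ y + ρ (h * Θ (φ x) * φ y))
    (P₂ : Submodule 𝒪[E] (Fin 2 → E) → Prop) (q : AddSubgroup M → Prop)
    (hq : ∀ B : Submodule 𝒪[E] (Fin 2 → E), IsSelfDualLattice σ ϖ H₂ B → mapGL γ₂ B = B → (P₂ B ↔ q (B.toAddSubgroup.map φ))) :
    {B : Submodule 𝒪[E] (Fin 2 → E) | IsSelfDualLattice σ ϖ H₂ B ∧ mapGL γ₂ B = B ∧ P₂ B}.ncard =
      {Λ : AddSubgroup M | (∃ z c : M, z ≠ 0 ∧ ρ c = c ∧ c ≠ 0 ∧ Valued.v c ≤ 1 ∧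
          ∀ x, x ∈ Λ ↔ ∃ y, (Valued.v y ≤ 1 ∧ Valued.v (y - ρ y) ≤ Valued.v (c * (α - ρ α))) ∧ x = z * y) ∧
        (∀ x ∈ Λ, lam * x ∈ Λ) ∧ (∀ m, (∀ a ∈ Λ, Valued.v (h * Θ a * m + ρ (h * Θ a * m)) ≤ 1) ↔ m ∈ Λ) ∧ q Λ}.ncard := by
  classical
  refine Set.ncard_congr (fun B _ => B.toAddSubgroup.map φ) ?_ ?_ ?_
  · -- into
    rintro B ⟨hSD, hfix, hP⟩
    have hqB : q (B.toAddSubgroup.map φ) := (hq B hSD hfix).1 hP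
    have hdual : dualLatt σ H₂ B = B := dualLatt_eq_self_of_isSelfDualLattice hvσ hH₂ hSD
    obtain ⟨g, hBg, -, -, -⟩ := hSD
    subst hBg
    refine ⟨?_, ?_, ?_, hqB⟩
    · exact exists_eq_mul_order_map_latt jE hρρ hα hα1 hint hjv hjfix φ hφs hφi g
    · exact (mapGL_eq_iff_forall_mul_mem jE hρρ hvρ hα hα1 hint hjv hjfix φ hφs hφi hφγ hlam g).1 hfix
    · exact forall_herm_iff_mem_of_dualLatt_eq σ H₂ jE ρ Θ h hjv φ hφi hφo hform hdual
  · -- injective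
    intro B B' _ _ hBB'
    exact map_toAddSubgroup_injective φ hφi hBB'
  · -- onto
    rintro Λ ⟨⟨z, c, hz0, hcfix, hc0, hc1, hΛ⟩, hstab, hself, hqΛ⟩
    obtain ⟨g, hg⟩ := exists_latt_map_eq_of_order jE hρρ hα hα1 hint hjv hjfix φ hφs hφo hz0 hcfix hc0 hc1 hΛ
    have hSD : IsSelfDualLattice σ ϖ H₂ (latt (g : Matrix (Fin 2) (Fin 2) E)) := by
      refine isSelfDualLattice_latt_of_dualLatt_eq σ hvσ hϖ0 hϖ1 hH₂ g ?_
      refine dualLatt_eq_of_forall_herm_iff_mem σ H₂ jE ρ Θ h hjv φ hφi hform ?_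
      rw [hg]; exact hself
    have hfix : mapGL γ₂ (latt (g : Matrix (Fin 2) (Fin 2) E)) = latt (g : Matrix (Fin 2) (Fin 2) E) := by
      refine (mapGL_eq_iff_forall_mul_mem jE hρρ hvρ hα hα1 hint hjv hjfix φ hφs hφi hφγ hlam g).2 ?_
      rw [hg]; exact hstab
    refine ⟨latt (g : Matrix (Fin 2) (Fin 2) E), ⟨hSD, hfix, ?_⟩, hg⟩
    exact (hq _ hSD hfix).2 (by rw [hg]; exact hqΛ)

/-! ## §2 ★ W4 with a label: the labelled W-side order census -/

/-- **(W4) WITH A LABEL.**  If the level-`0` sets are finite and `lam ∉ 𝒪_{ϖE^{J+1}}`, then for any M-label `q`: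
`#{Λ ∣ Λ = z·𝒪_c ∧ lam·Λ ⊆ Λ ∧ Λ = Λ^♯ ∧ q Λ} = Σ_{j < J+1} [IsOrd (ϖE^j) lam]·#(levelSet(j, 0) ∩ {Λ ∣ q Λ})` — ★ (W4a)'s set identity intersected with `{q}`, then the count
by conductor as in ★ W4. [cite: Kottwitz1986BaseChangeUnits, §1 pp. 240–241] [cite: Flicker1998UnitaryFL, p. 84 REMARK] [cite: Jacobowitz1962, §7] -/
theorem ncard_orderLatt_selfDual_sep_eq_sum (hρρ : ∀ x, ρ (ρ x) = x) (hvρ : ∀ x, Valued.v (ρ x) = Valued.v x) (hα : ρ α ≠ α) (hα1 : Valued.v α ≤ 1)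
    (hint : ∀ z : M, Valued.v z ≤ 1 → Valued.v ((z - ρ z) / (α - ρ α)) ≤ 1)
    (hΘΘ : ∀ x, Θ (Θ x) = x) (hΘρ : ∀ x, Θ (ρ x) = ρ (Θ x)) (hvΘ : ∀ x, Valued.v (Θ x) = Valued.v x)
    {ϖE : M} (hρϖ : ρ ϖE = ϖE) (hϖ0 : ϖE ≠ 0) (hϖ1 : Valued.v ϖE < 1)
    (hEval : ∀ c : M, ρ c = c → c ≠ 0 → Valued.v c ≤ 1 → ∃ n : ℕ, Valued.v c = Valued.v ϖE ^ n)
    {h : M} (hh : h ≠ 0) (lam : M) {J : ℕ} (hJ : ¬ IsOrd ρ α (ϖE ^ (J + 1)) lam) (hfin : ∀ j, (levelSet ρ Θ α ϖE h j 0).Finite)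
    (q : AddSubgroup M → Prop) :
    {Λ : AddSubgroup M | (∃ z c : M, z ≠ 0 ∧ ρ c = c ∧ c ≠ 0 ∧ Valued.v c ≤ 1 ∧ ∀ x, x ∈ Λ ↔ ∃ y, IsOrd ρ α c y ∧ x = z * y) ∧
        (∀ x ∈ Λ, lam * x ∈ Λ) ∧ (∀ m, (∀ a ∈ Λ, Valued.v (h * Θ a * m + ρ (h * Θ a * m)) ≤ 1) ↔ m ∈ Λ) ∧ q Λ}.ncard =
      ∑ j ∈ Finset.range (J + 1), (if IsOrd ρ α (ϖE ^ j) lam then (levelSet ρ Θ α ϖE h j 0 ∩ {Λ | q Λ}).ncard else 0) := by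
  classical
  -- ★ (W4a) intersected with the label
  have hset : {Λ : AddSubgroup M | (∃ z c : M, z ≠ 0 ∧ ρ c = c ∧ c ≠ 0 ∧ Valued.v c ≤ 1 ∧ ∀ x, x ∈ Λ ↔ ∃ y, IsOrd ρ α c y ∧ x = z * y) ∧
        (∀ x ∈ Λ, lam * x ∈ Λ) ∧ (∀ m, (∀ a ∈ Λ, Valued.v (h * Θ a * m + ρ (h * Θ a * m)) ≤ 1) ↔ m ∈ Λ) ∧ q Λ} =
      {Λ : AddSubgroup M | (∃ z c : M, z ≠ 0 ∧ ρ c = c ∧ c ≠ 0 ∧ Valued.v c ≤ 1 ∧ ∀ x, x ∈ Λ ↔ ∃ y, IsOrd ρ α c y ∧ x = z * y) ∧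
        (∀ x ∈ Λ, lam * x ∈ Λ) ∧ (∀ m, (∀ a ∈ Λ, Valued.v (h * Θ a * m + ρ (h * Θ a * m)) ≤ 1) ↔ m ∈ Λ)} ∩ {Λ | q Λ} := by
    ext Λ; simp only [Set.mem_setOf_eq, Set.mem_inter_iff, and_assoc]
  rw [hset, setOf_orderLatt_selfDual_eq_iUnion hρρ hvρ hα hα1 hint hΘΘ hΘρ hvΘ hρϖ hϖ0 hϖ1 hEval hh lam, Set.iUnion_inter]
  -- the labelled pieces
  set S : ℕ → Set (AddSubgroup M) := fun j => {Λ | Λ ∈ levelSet ρ Θ α ϖE h j 0 ∧ IsOrd ρ α (ϖE ^ j) lam} ∩ {Λ | q Λ} with hS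
  have hSfin : ∀ j, (S j).Finite := fun j => (hfin j).subset fun Λ hΛ => hΛ.1.1
  have hSdisj : ∀ i j, i ≠ j → Disjoint (S i) (S j) := by
    intro i j hij
    rw [Set.disjoint_left]
    intro Λ hi hj
    exact hij (eq_of_mem_levelSet_of_mem_levelSet hvρ hα hα1 hint hρϖ hϖ0 hϖ1 h hi.1.1 hj.1.1)
  have hSempty : ∀ j, J < j → S j = ∅ := by
    intro j hj
    ext Λ
    simp only [hS, Set.mem_inter_iff, Set.mem_setOf_eq, Set.mem_empty_iff_false, iff_false]
    rintro ⟨⟨-, hl⟩, -⟩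
    exact not_isOrd_pow_of_lt hϖ1.le hJ hj hl
  have hScard : ∀ j, (S j).ncard = if IsOrd ρ α (ϖE ^ j) lam then (levelSet ρ Θ α ϖE h j 0 ∩ {Λ | q Λ}).ncard else 0 := by
    intro j
    split_ifs with hlam
    · congr 1; ext Λ
      simp only [hS, Set.mem_inter_iff, Set.mem_setOf_eq]
      exact ⟨fun hΛ => ⟨hΛ.1.1, hΛ.2⟩, fun hΛ => ⟨⟨hΛ.1, hlam⟩, hΛ.2⟩⟩
    · rw [Set.ncard_eq_zero (hSfin j)]; ext Λ
      simp only [hS, Set.mem_inter_iff, Set.mem_setOf_eq, Set.mem_empty_iff_false, iff_false]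
      rintro ⟨⟨-, hl⟩, -⟩
      exact hlam hl
  -- truncate the union at `J` and count by induction (★ W4's bookkeeping)
  have hUnion : (⋃ j : ℕ, S j) = ⋃ j ∈ Finset.range (J + 1), S j := by
    ext Λ
    simp only [Set.mem_iUnion, Finset.mem_range, exists_prop]
    constructor
    · rintro ⟨j, hj⟩
      refine ⟨j, ?_, hj⟩
      by_contra hJj
      have : S j = ∅ := hSempty j (by omega)
      rw [this] at hj; exact hj
    · rintro ⟨j, -, hj⟩; exact ⟨j, hj⟩
  rw [show (⋃ j : ℕ, {Λ | Λ ∈ levelSet ρ Θ α ϖE h j 0 ∧ IsOrd ρ α (ϖE ^ j) lam} ∩ {Λ | q Λ}) = ⋃ j : ℕ, S j from rfl, hUnion]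
  have hgen : ∀ n : ℕ, (⋃ j ∈ Finset.range n, S j).ncard = ∑ j ∈ Finset.range n, (S j).ncard := by
    intro n
    induction n with
    | zero => simp
    | succ n ih =>
      rw [Finset.range_add_one, Finset.sum_insert Finset.notMem_range_self, Finset.set_biUnion_insert]
      have hdisj : Disjoint (S n) (⋃ x ∈ Finset.range n, S x) := by
        rw [Set.disjoint_left]
        intro Λ hn hU
        simp only [Set.mem_iUnion, Finset.mem_range, exists_prop] at hU
        obtain ⟨j, hj, hΛj⟩ := hU
        exact (Set.disjoint_left.1 (hSdisj n j (by omega))) hn hΛj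
      rw [Set.ncard_union_eq hdisj (hSfin n) ?_, ih]
      exact (Finset.range n).finite_toSet.biUnion fun j _ => hSfin j
  rw [hgen]
  exact Finset.sum_congr rfl fun j _ => hScard j

/-! ## §3 HEAD — the labelled axis term in M-letters -/

/-- **THE LABELLED AXIS TERM IN M-LETTERS.**  `#{B₂ ∣ B₂ self-dual for H₂, γ₂B₂ = B₂, P₂ B₂} = Σ_{j < J+1} [IsOrd (jE ϖ^j) lam]·#(levelSet(j, 0) ∩ {Λ ∣ q Λ})` — ★ (C1) §1
`ncard_selfDual_fixed_plane_eq_sum_levelSet_zero`'s frame VERBATIM plus `(P₂) (q) (hq)`; = §1 ∘ §2.  The left side is ★ p860968 §3's axis term at `Q₂ := P₂`.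
[cite: Kottwitz1986BaseChangeUnits, §1 pp. 240–241] [cite: Flicker1998UnitaryFL, p. 84 REMARK] [cite: Jacobowitz1962, §4] [cite: BruhatTits1972, §10] -/
theorem ncard_selfDual_fixed_plane_sep_eq_sum_levelSet_zero (σ : E →+* E) (hvσ : ∀ a, Valued.v (σ a) = Valued.v a) {ϖ : E} (hϖ : Valued.v ϖ = WithZero.exp (-1 : ℤ))
    {H₂ : Matrix (Fin 2) (Fin 2) E} (hH₂ : IsUnit H₂.det) (jE : E →+* M)
    (hρρ : ∀ x, ρ (ρ x) = x) (hvρ : ∀ x, Valued.v (ρ x) = Valued.v x) (hα : ρ α ≠ α) (hα1 : Valued.v α ≤ 1)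
    (hint : ∀ z : M, Valued.v z ≤ 1 → Valued.v ((z - ρ z) / (α - ρ α)) ≤ 1)
    (hΘΘ : ∀ x, Θ (Θ x) = x) (hΘρ : ∀ x, Θ (ρ x) = ρ (Θ x)) (hvΘ : ∀ x, Valued.v (Θ x) = Valued.v x)
    (hjv : ∀ c, Valued.v (jE c) ≤ 1 ↔ Valued.v c ≤ 1) (hjfix : ∀ z, ρ z = z ↔ ∃ c, jE c = z)
    (hjpow : ∀ (t : E) (n : ℤ), Valued.v (jE t) = Valued.v (jE ϖ) ^ n ↔ Valued.v t = Valued.v ϖ ^ n)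
    (hEval : ∀ c : M, ρ c = c → c ≠ 0 → Valued.v c ≤ 1 → ∃ n : ℕ, Valued.v c = Valued.v (jE ϖ) ^ n)
    (φ : (Fin 2 → E) →+ M) (hφs : ∀ (c : E) (x : Fin 2 → E), φ (c • x) = jE c * φ x) (hφi : Function.Injective φ) (hφo : Function.Surjective φ)
    {γ₂ : GL (Fin 2) E} {lam h : M} (hφγ : ∀ x, φ ((γ₂ : Matrix (Fin 2) (Fin 2) E).mulVec x) = lam * φ x) (hlam : Valued.v lam = 1)
    (hh : h ≠ 0) (hform : ∀ x y, jE (pairing σ H₂ x y) = h * Θ (φ x) * φ y + ρ (h * Θ (φ x) * φ y))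
    {J : ℕ} (hJ : ¬ IsOrd ρ α (jE ϖ ^ (J + 1)) lam) (hfin0 : ∀ j, (levelSet ρ Θ α (jE ϖ) h j 0).Finite)
    (P₂ : Submodule 𝒪[E] (Fin 2 → E) → Prop) (q : AddSubgroup M → Prop)
    (hq : ∀ B : Submodule 𝒪[E] (Fin 2 → E), IsSelfDualLattice σ ϖ H₂ B → mapGL γ₂ B = B → (P₂ B ↔ q (B.toAddSubgroup.map φ))) :
    {B : Submodule 𝒪[E] (Fin 2 → E) | IsSelfDualLattice σ ϖ H₂ B ∧ mapGL γ₂ B = B ∧ P₂ B}.ncard =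
      ∑ j ∈ Finset.range (J + 1), (if IsOrd ρ α (jE ϖ ^ j) lam then (levelSet ρ Θ α (jE ϖ) h j 0 ∩ {Λ | q Λ}).ncard else 0) := by
  have hvϖ0 : Valued.v ϖ ≠ 0 := by rw [hϖ]; exact WithZero.exp_ne_zero
  have hϖ0 : ϖ ≠ 0 := fun h0 => by rw [h0, map_zero] at hvϖ0; exact hvϖ0 rfl
  have hϖ1 : Valued.v ϖ < 1 := by rw [hϖ, ← WithZero.exp_zero, WithZero.exp_lt_exp]; norm_num
  have hρϖ : ρ (jE ϖ) = jE ϖ := (hjfix _).2 ⟨ϖ, rfl⟩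
  have hϖE0 : jE ϖ ≠ 0 := (map_ne_zero jE).2 hϖ0
  have hϖE1 : Valued.v (jE ϖ) < 1 := by
    refine lt_of_le_of_ne ((hjv ϖ).2 hϖ1.le) fun hle => ?_
    have := (hjpow ϖ 0).1 (by rw [zpow_zero]; exact hle)
    rw [zpow_zero] at this
    exact hϖ1.ne this
  -- §1: transport to the labelled order lattices of the line model
  rw [ncard_selfDual_fixed_sep_eq_ncard_orderLatt_sep σ hvσ hϖ0 hϖ1.le hH₂ jE hρρ hvρ hα hα1 hint hjv hjfix φ hφs hφi hφo hφγ hlam hform P₂ q hq]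
  -- §2: the labelled census by conductor (its set is §1's with `IsOrd` folded — definitional)
  exact ncard_orderLatt_selfDual_sep_eq_sum hρρ hvρ hα hα1 hint hΘΘ hΘρ hvΘ hρϖ hϖE0 hϖE1 hEval hh lam hJ hfin0 q

end Summit.HodgeConjecture.HodgeConjecture.Cruxes.H413.F0P3cDyRamWSideOrderCensusLabelled

end
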